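import Literature.MathematicalPhysics.QuantumFieldTheory.Balaban1983to89.B6TranslateTorusV1

/-!
# `Balaban1983to89.B6InMajorantTransplant` — T. Bałaban, *Propagators and renormalization transformations for lattice gauge theories. II*,
# Commun. Math. Phys. **96** (1984) 223–250 [Balaban1984PropagatorsII], (2.133)–(2.134) p. 247 with (2.91)–(2.93) p. 239: INPUT-LOCALISED
# MAJORANTS («supp J ⊂ Δ(y′), y′ ∈ S», outputs ANYWHERE) — the notion, its transport through window charts and chart translations, and the
# UNIFORM BOUND of the transplanted two-scale `G_□` on the V1 torus for central inputs

statement-level skeleton of published theorems with citation tags; proofs where landed; nothing here is a claim about the Yang–Mills mass gap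

PDF held: `paper:balaban1984-cmp96-propagators-rt-ii` (journal page = PDF page + 222): p. 239 [PDF 17] ((2.91)–(2.93): every term of `K_□′` carries `h_□′`
or `[Δ_a, h_□′]` on the left — INPUTS of `G_□′` are central, `supp h_□′ ⊂ □′`), p. 247 [PDF 25] ((2.133): *"for x ∈ Δ(y), supp J ⊂ Δ(y′), y, y′ ∈
𝔅 ∩ T_□"*; (2.134)).

CITATION HEADER (lean-in-tree rule) — WHAT IS REPRODUCED.  Phase-2 file of the `lit-balaban` typed skeleton (HOME `run/shared/lean/pub/lit-balaban/`),
seat **r03 gen 20**; SKELETON rows **B6.Eq2.133** × **B6.Eq2.134** × B6.Prop2.6 (cells).  Owner's finding F4 (B6-CLOSURE §5 item 14): the (2.134)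
consumer (`…B6Ineq2134KFamKLevelTorus.h2134_kFam_torus`) reads the member `G_□′` at ARBITRARY outputs but only with inputs supported in the central
reach `S_□′` (print's left factors `h_□′`, `[Δ_a, h_□′]` localise the outputs; the non-local `∂P∂*`-sandwich reads `G_□′h_□′` everywhere with its own
decay), while a transplanted torus-window member has NO global-distance decay at wrap-around pairs.  THIS FILE supplies the input-localised language:
* §1 **`InMajorant blk T S K`** `:= ∀ y′ ∈ S, ∀ μ B, BlockSupp blk μ y′ B → ∀ x, |T μ x| ≤ K (blk x) y′ · B` (`LocalMajorant` without the output
  restriction; `HasMajorant` restricted to inputs over `S`): `inMajorant_of_hasMajorant`, `InMajorant.localMajorant`, `inMajorant_mono`,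
  `inMajorant_smul`, `inMajorant_congr_set`;
* §2 **`inMajorant_transplant`** — the twin of `B6Prop26ReachTransplant.localMajorant_transplant` with the kernel comparison asked only for inputs over
  `S` (outputs anywhere in the window; zero outside);
* §3 **`inMajorant_relabel`**, **`inMajorant_conj_chart`** — transport along a relabelling / the chart translation of `B6TranslateTorusV1`;
* §4 **`inMajorant_GlV1_bdd`** — THE UNIFORM BOUND: for the constants `A` of `B6Ineq2133TwoScaleV1.ineq2133_G` (on `d, L, a₀, a₁`), every member `t`,
  every V1 global torus (`hN`), window corner `x₀` (full member period inside the box, `L^j ∣ x₀`), half-period sub-window `[x₀, x₀ + Wd)` that is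
  two-level, and every reach `S` whose bonds lie in the sub-window: `InMajorant (blkV1 hN D) (GlV1 t hN (cB t x₀ …).W x₀) S (fun _ _ ↦ L^{d+1}·A)`
  — `|G_□ μ x| ≤ L^{d+1}A·B` for inputs over `S`, ALL outputs `x` (the member's (2.133) majorant with `e^{−δ d_{T_□}} ≤ 1`, `≤ L^{d+1}` charted
  `j`-blocks over a global block).
No new definition of mathematical content beyond `InMajorant`; no new fact; standard axioms.
HONEST SCOPE. Bookkeeping; the bound of §4 is uniform (no decay) — decay for far outputs is FALSE for window members (F4) and not needed by print;
decay on the central reach is `B6FullWindowReachV1.reach2133_G_V1_full`. NOT summit progress.  Unit `lit-balaban-r03` (gen 20), 2026-08-23.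
-/

noncomputable section

open scoped BigOperators
open Finset

namespace Literature.MathematicalPhysics.QuantumFieldTheory.Balaban1983to89.B6InMajorantTransplant

open B6RandomWalk (HasMajorant BlockSupp blockPiece sum_blockPiece blockSupp_blockPiece)
open B6Prop26Gluing (LocalMajorant)
open B6Prop26ReachTransplant (restrictOp transplant restrictOp_apply transplant_apply restrictOp_apply_of_injOn restrictOp_apply_of_not_mem)

/-! ## §1  Input-localised majorants -/

section Defs

variable {g : B6.Geometry} {X : Type}

/-- **INPUT-LOCALISED MAJORANT**: `|(Tμ)(x)| ≤ K(y(x), y′)·B` for every `μ` supported in the block of `y′ ∈ S` with `|μ| ≤ B`, and EVERY output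
point `x` (print's «supp J ⊂ Δ(y′), y′ ∈ 𝔅 ∩ T_□», outputs unrestricted). [cite: Balaban1984PropagatorsII, (2.133) p.247, (2.91)–(2.93) p.239] -/
def InMajorant (blk : X → g.Site) (T : Module.End ℝ (X → ℝ)) (S : Set g.Site) (K : g.Site → g.Site → ℝ) : Prop :=
  ∀ y' ∈ S, ∀ (μ : X → ℝ) (B : ℝ), BlockSupp blk μ y' B → ∀ x : X, |T μ x| ≤ K (blk x) y' * B

/-- a global majorant is an input-localised one on every set. [cite: Balaban1984PropagatorsII, (2.51) p.232, bookkeeping] -/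
theorem inMajorant_of_hasMajorant (blk : X → g.Site) {T : Module.End ℝ (X → ℝ)} {K : g.Site → g.Site → ℝ} (h : HasMajorant blk T K)
    (S : Set g.Site) : InMajorant blk T S K :=
  fun y' _ μ B hμ x => h y' μ B hμ x

/-- an input-localised majorant is a local one on its set. [cite: Balaban1984PropagatorsII, (2.133) p.247, bookkeeping] -/
theorem InMajorant.localMajorant {blk : X → g.Site} {T : Module.End ℝ (X → ℝ)} {S : Set g.Site} {K : g.Site → g.Site → ℝ}
    (h : InMajorant blk T S K) : LocalMajorant blk T S K :=
  fun y' hy' μ B hμ x _ => h y' hy' μ B hμ x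

/-- monotonicity in the kernel (inputs over `S`). [cite: Balaban1984PropagatorsII, (2.133) p.247, bookkeeping] -/
theorem inMajorant_mono (blk : X → g.Site) {T : Module.End ℝ (X → ℝ)} {S : Set g.Site} {K K' : g.Site → g.Site → ℝ}
    (h : InMajorant blk T S K) (hle : ∀ a, ∀ b ∈ S, K a b ≤ K' a b) : InMajorant blk T S K' :=
  fun y' hy' μ B hμ x => (h y' hy' μ B hμ x).trans (mul_le_mul_of_nonneg_right (hle _ _ hy') hμ.nonneg)

/-- scaling. [cite: Balaban1984PropagatorsII, (2.94) p.239, bookkeeping] -/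
theorem inMajorant_smul (blk : X → g.Site) {T : Module.End ℝ (X → ℝ)} {S : Set g.Site} {K : g.Site → g.Site → ℝ}
    (h : InMajorant blk T S K) (s : ℝ) : InMajorant blk (s • T) S (fun a b => |s| * K a b) := by
  intro y' hy' μ B hμ x
  rw [LinearMap.smul_apply, Pi.smul_apply, smul_eq_mul, abs_mul, mul_assoc]
  exact mul_le_mul_of_nonneg_left (h y' hy' μ B hμ x) (abs_nonneg _)

/-- the set may be replaced by one with the same members. [cite: Balaban1984PropagatorsII, (2.133) p.247, bookkeeping] -/
theorem inMajorant_congr_set (blk : X → g.Site) {T : Module.End ℝ (X → ℝ)} {S S' : Set g.Site} {K : g.Site → g.Site → ℝ}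
    (hS : ∀ a, a ∈ S ↔ a ∈ S') (h : InMajorant blk T S K) : InMajorant blk T S' K :=
  fun y' hy' μ B hμ x => h y' ((hS y').2 hy') μ B hμ x

/-- restriction to a smaller input set. [cite: Balaban1984PropagatorsII, (2.133) p.247, bookkeeping] -/
theorem inMajorant_subset (blk : X → g.Site) {T : Module.End ℝ (X → ℝ)} {S S' : Set g.Site} {K : g.Site → g.Site → ℝ}
    (h : InMajorant blk T S K) (hS : S' ⊆ S) : InMajorant blk T S' K :=
  fun y' hy' μ B hμ x => h y' (hS hy') μ B hμ x

end Defs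

/-! ## §2  Transport through a window chart: outputs anywhere -/

section Transplant

variable {X X' : Type} [DecidableEq X'] [DecidableEq X] {W : Finset X} {e : X → X'}

/-- **TRANSPORT OF A MAJORANT THROUGH THE CHART, INPUTS OVER `S`, OUTPUTS ANYWHERE**: if `T′` has the majorant `K′` on the local lattice, the
chart is injective on the window `W`, the kernels compare for window outputs `x` and window inputs `x₁` over `S`, and every `y ∈ S` is charted into at
most `n` local blocks, then `|(transplant T′) μ (x)| ≤ n·K(y(x), y′)·B` for `μ` over `y′ ∈ S` and ALL `x` (zero off `W`).
[cite: Balaban1984PropagatorsII, (2.133) p.247, (2.90)–(2.91) p.239; derivation ours] -/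
theorem inMajorant_transplant {g g' : B6.Geometry} (blk : X → g.Site) (blk' : X' → g'.Site) (S : Set g.Site)
    (hinj : Set.InjOn e ↑W) {T' : Module.End ℝ (X' → ℝ)} {K' : g'.Site → g'.Site → ℝ} (hT' : HasMajorant blk' T' K')
    (K : g.Site → g.Site → ℝ) (hK : ∀ a b, 0 ≤ K a b)
    (hcomp : ∀ x ∈ W, ∀ x₁ ∈ W, blk x₁ ∈ S → K' (blk' (e x)) (blk' (e x₁)) ≤ K (blk x) (blk x₁))
    (n : ℕ) (hfib : ∀ y ∈ S, ∃ T : Finset g'.Site, T.card ≤ n ∧ ∀ x ∈ W, blk x = y → blk' (e x) ∈ T) :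
    InMajorant blk (transplant W e T') S (fun a b => n * K a b) := by
  classical
  intro y' hy' μ B hμ x
  obtain ⟨T, hTn, hT⟩ := hfib y' hy'
  have hB : 0 ≤ B := hμ.nonneg
  have hnKB : 0 ≤ (n : ℝ) * K (blk x) y' * B := mul_nonneg (mul_nonneg (Nat.cast_nonneg _) (hK _ _)) hB
  rw [transplant_apply]
  by_cases hxW : x ∈ W
  swap
  · rw [if_neg hxW, abs_zero]
    exact hnKB
  rw [if_pos hxW]
  set ν : X' → ℝ := restrictOp W e μ with hν
  set F : Finset g'.Site := (W.filter (fun x => blk x = y')).image (fun x => blk' (e x)) with hF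
  -- `|ν| ≤ B` everywhere, and `ν` lives over the local blocks of `F`
  have hA : ∀ x', |ν x'| ≤ B ∧ (ν x' ≠ 0 → blk' x' ∈ F) := by
    intro x'
    by_cases hex : ∃ x₁ ∈ W, e x₁ = x'
    · obtain ⟨x₁, hx₁, rfl⟩ := hex
      rw [hν, restrictOp_apply_of_injOn hinj μ hx₁]
      by_cases hb : blk x₁ = y'
      · refine ⟨hμ.bound x₁ hb, fun _ => ?_⟩
        rw [hF, Finset.mem_image]
        exact ⟨x₁, Finset.mem_filter.mpr ⟨hx₁, hb⟩, rfl⟩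
      · rw [hμ.off x₁ hb, abs_zero]
        exact ⟨hB, fun h => absurd rfl h⟩
    · push Not at hex
      rw [hν, restrictOp_apply_of_not_mem μ hex, abs_zero]
      exact ⟨hB, fun h => absurd rfl h⟩
  have hBsum : ν = ∑ b ∈ F, blockPiece blk' b ν := by
    have hsub : ∑ b ∈ F, blockPiece blk' b ν = ∑ b, blockPiece blk' b ν := by
      refine Finset.sum_subset (Finset.subset_univ F) fun b _ hbF => ?_
      funext x'
      simp only [blockPiece, Pi.zero_apply]
      split_ifs with hbx
      · by_contra hne
        exact hbF (hbx ▸ (hA x').2 hne)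
      · rfl
    rw [hsub, sum_blockPiece]
  have hpiece : ∀ b ∈ F, |T' (blockPiece blk' b ν) (e x)| ≤ K (blk x) y' * B := by
    intro b hb
    have hsupp : BlockSupp blk' (blockPiece blk' b ν) b B := blockSupp_blockPiece blk' ν b B hB fun x' _ => (hA x').1
    refine (hT' b _ B hsupp (e x)).trans (mul_le_mul_of_nonneg_right ?_ hB)
    obtain ⟨x₁, hx₁, rfl⟩ := Finset.mem_image.mp hb
    obtain ⟨hx₁W, hbx₁⟩ := Finset.mem_filter.mp hx₁
    have h := hcomp x hxW x₁ hx₁W (hbx₁ ▸ hy')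
    rwa [hbx₁] at h
  calc |T' ν (e x)| = |(∑ b ∈ F, T' (blockPiece blk' b ν)) (e x)| := by
          conv_lhs => rw [hBsum]
          rw [map_sum]
    _ = |∑ b ∈ F, T' (blockPiece blk' b ν) (e x)| := by rw [Finset.sum_apply]
    _ ≤ ∑ b ∈ F, |T' (blockPiece blk' b ν) (e x)| := Finset.abs_sum_le_sum_abs _ _
    _ ≤ ∑ b ∈ F, K (blk x) y' * B := Finset.sum_le_sum hpiece
    _ = F.card * (K (blk x) y' * B) := by rw [Finset.sum_const, nsmul_eq_mul]
    _ ≤ n * (K (blk x) y' * B) := by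
          refine mul_le_mul_of_nonneg_right (Nat.cast_le.mpr ?_) (mul_nonneg (hK _ _) hB)
          have hFT : F ⊆ T := by
            intro b hb
            obtain ⟨x₁, hx₁, rfl⟩ := Finset.mem_image.mp hb
            obtain ⟨hx₁W, hbx₁⟩ := Finset.mem_filter.mp hx₁
            exact hT x₁ hx₁W hbx₁
          exact (Finset.card_le_card hFT).trans hTn
    _ = n * K (blk x) y' * B := by ring

end Transplant

/-! ## §3  Transport along a relabelling of the fine lattice and of `𝔅`; the chart translation of the V1 torus -/

section Relabel

variable {g₁ g₂ : B6.Geometry} {X : Type}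

/-- **INPUT-LOCALISED MAJORANTS TRANSPORT ALONG A RELABELLING** (`blk₁ ∘ φ = e ∘ blk₂`, `(T₁f)(φx) = (T₂(f ∘ φ))(x)`, `S₁ = e″S₂`).
[cite: Balaban1984PropagatorsII, (2.133) p.247, dictionary (charts)] -/
theorem inMajorant_relabel (φ : X ≃ X) (e : g₂.Site → g₁.Site) (he : Function.Injective e) (blk₁ : X → g₁.Site) (blk₂ : X → g₂.Site)
    (hblk : ∀ x, blk₁ (φ x) = e (blk₂ x)) {T₁ T₂ : Module.End ℝ (X → ℝ)} (hT : ∀ f x, T₁ f (φ x) = T₂ (f ∘ φ) x)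
    {S₁ : Set g₁.Site} {S₂ : Set g₂.Site} (hS : ∀ a, e a ∈ S₁ ↔ a ∈ S₂) (hS₁ : ∀ y ∈ S₁, ∃ a, e a = y)
    {K₁ : g₁.Site → g₁.Site → ℝ} {K₂ : g₂.Site → g₂.Site → ℝ} (h₂ : InMajorant (g := g₂) blk₂ T₂ S₂ K₂)
    (hK : ∀ a b, K₂ a b ≤ K₁ (e a) (e b)) : InMajorant (g := g₁) blk₁ T₁ S₁ K₁ := by
  intro y' hy' μ B hμ x
  obtain ⟨x₂, rfl⟩ := φ.surjective x
  obtain ⟨b, rfl⟩ := hS₁ y' hy'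
  rw [hT, hblk]
  have hμ' : BlockSupp (g := g₂) blk₂ (μ ∘ φ) b B :=
    ⟨hμ.nonneg, fun x' hx' => hμ.bound (φ x') (by rw [hblk, hx']),
      fun x' hx' => hμ.off (φ x') fun h => hx' (he (by rw [← hblk, h]))⟩
  exact (h₂ b ((hS b).1 hy') (μ ∘ φ) B hμ' x₂).trans (mul_le_mul_of_nonneg_right (hK _ _) hμ.nonneg)

end Relabel

section Torus

open B6TranslateV1 (tv)
open B6TranslateTorusV1 (vch TB conj_apply blkV1_translate)
open B6GlobalChartV1 (PV blkV1)
open B6MultiLevelBoxOperator (N0)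
open B6MultiLevelTorusOperator (TDomains)
open B6Geom246MultiLevelTorus (geomT blkMap blkMap_injective)

variable {d ℓ : ℕ} {hd : 1 ≤ d + 1} {hL : Odd (ℓ + 1) ∧ 1 < ℓ + 1} {m K : ℕ} {Mh k R : ℕ} {P' : Fin (d + 1) → ℕ}
variable (hN : ∀ μ, N0 ℓ Mh k P' μ = (PV d ℓ m K hd hL).sitesPerDir 0) (D : TDomains d ℓ Mh k P' R) (hMh : 1 ≤ Mh) (hP : ∀ μ, 1 ≤ P' μ)
  (s : Fin (d + 1) → ℤ)

include hMh hP in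
/-- **INPUT-LOCALISED MAJORANTS IN THE CHART FRAME ARE ONES IN THE GLOBAL FRAME** for the conjugate `τ_{-v} T₂ τ_v` (input set carried by the
block map). [cite: Balaban1984PropagatorsII, (2.133) p.247 + (2.45)–(2.46) p.231, dictionary (charts)] -/
theorem inMajorant_conj_chart {T₂ : Module.End ℝ (PBond (PV d ℓ m K hd hL) 0 → ℝ)} {S : Set (geomT (D.chart s)).Site}
    {K : (geomT (D.chart s)).Site → (geomT (D.chart s)).Site → ℝ} {K' : (geomT D).Site → (geomT D).Site → ℝ}
    (h₂ : InMajorant (g := geomT (D.chart s)) (blkV1 hN (D.chart s)) T₂ S K)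
    (hK : ∀ a b, K a b ≤ K' (blkMap D s a) (blkMap D s b)) :
    InMajorant (g := geomT D) (blkV1 hN D) (TB (-vch Mh k s) * T₂ * TB (vch Mh k s)) (blkMap D s '' S) K' :=
  inMajorant_relabel (g₁ := geomT D) (g₂ := geomT (D.chart s)) (PBond.translateEquiv (vch Mh k s)) (blkMap D s)
    (blkMap_injective hMh hP s) (blkV1 hN D) (blkV1 hN (D.chart s))
    (fun b => blkV1_translate hN D hMh hP s b) (fun f b => conj_apply s T₂ f b)
    (fun a => ⟨fun ha => by
        obtain ⟨a', ha', he⟩ := (Set.mem_image _ _ _).1 ha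
        rwa [← blkMap_injective hMh hP s he], fun ha => Set.mem_image_of_mem _ ha⟩)
    (fun y hy => by
        obtain ⟨a, _, he⟩ := (Set.mem_image _ _ _).1 hy
        exact ⟨a, he⟩) h₂ hK

end Torus

/-! ## §4  The uniform bound of the transplanted `G_□` on the V1 torus for central inputs -/

section Uniform

open B5Eq118OneStroke (iterBlockOf)
open B6Prop25TwoScaleCensus (TSIdx)
open B6Ineq2133TwoScaleV1 (tsGeo onFun ineq2133_G)
open B6GlobalChartV1 (PV GlV1 toBox blkV1)
open B6MultiLevelBoxOperator (N0)
open B6MultiLevelTorusOperator (TDomains)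
open B6Geom246MultiLevelTorus (geomT)
open B4Reflection242 (boxDom)
open B6AgreeLapV1Chart (cB eB DeepB mem_cB_W GlV1_eq eB_eq_chartBond)
open B6Prop26ReachTransplant (chartBond InWindow hfib_sites)

variable {d ℓ : ℕ}

/-- **THE UNIFORM INPUT-LOCALISED BOUND OF THE FULL-WINDOW `GlV1`**: for the constant `A` of the two-scale (2.133) majorant
(`B6Ineq2133TwoScaleV1.ineq2133_G`; on `d, L, a₀, a₁`), every member `t`, V1 global torus (`hN`), corner `x₀ ≥ 0` with the member period inside the
box (`hfit`), `L^j ∣ x₀`, every two-level half-period sub-window `[x₀, x₀ + Wd)` and every input set `S` whose bonds lie in the sub-window: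
`|G_□ μ x| ≤ L^{d+1}·A·B` for `μ` over `y′ ∈ S`, `|μ| ≤ B`, and ALL `x` — no decay claimed (none holds at wrap-around outputs).
[cite: Balaban1984PropagatorsII, (2.133) p.247, (2.90)–(2.91) p.239, p.238 (T_□ = □̃³)] -/
theorem inMajorant_GlV1_bdd (d ℓ : ℕ) (hd : 1 ≤ d + 1) (hL : Odd (ℓ + 1) ∧ 1 < ℓ + 1) {a₀ a₁ : ℝ} (ha₀ : 0 < a₀) (ha₁ : a₀ ≤ a₁) :
    ∃ A : ℝ, 0 ≤ A ∧ ∀ (t : TSIdx d (ℓ + 1) hd hL a₀ a₁) (m K : ℕ) {Mh k R : ℕ} {P' : Fin (d + 1) → ℕ}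
      (hN : ∀ μ, N0 ℓ Mh k P' μ = (PV d ℓ m K hd hL).sitesPerDir 0) (D : TDomains d ℓ Mh k P' R)
      (x₀ : Fin (d + 1) → ℤ) (hx₀ : ∀ μ, 0 ≤ x₀ μ) (hfit : ∀ μ, x₀ μ + (t.P.sitesPerDir 0 : ℕ) ≤ ((PV d ℓ m K hd hL).sitesPerDir 0 : ℕ))
      (_ : ∀ μ, (((ℓ + 1) ^ t.j : ℕ) : ℤ) ∣ x₀ μ) (Wd : ℕ) (_ : Wd ≤ (ℓ + 1) ^ (t.m + t.K))
      (_ : ∀ z ∈ boxDom (N0 ℓ Mh k P'), (∀ μ, x₀ μ ≤ z μ ∧ z μ < x₀ μ + Wd) → t.j ≤ D.lev z ∧ D.lev z ≤ t.j + 1)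
      (S : Set (geomT D).Site)
      (_ : ∀ b : PBond (PV d ℓ m K hd hL) 0, blkV1 hN D b ∈ S →
        InWindow (fun b : PBond (PV d ℓ m K hd hL) 0 => (toBox hN b.src : Fin (d + 1) → ℤ)) x₀ Wd b),
      InMajorant (g := geomT D) (blkV1 hN D) (GlV1 t hN (cB t x₀ hx₀ hfit).W x₀) S
        (fun _ _ => ((ℓ + 1) ^ (d + 1) : ℕ) * A) := by
  obtain ⟨δ, hδ, A, hA, h⟩ := ineq2133_G d (ℓ + 1) hd hL ha₀ ha₁
  refine ⟨A, hA, fun t m K Mh k R P' hN D x₀ hx₀ hfit hdiv Wd hWd hlev S hS => ?_⟩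
  classical
  rw [GlV1_eq]
  -- the sub-window of the reach and its fibre count
  let W' : Finset (PBond (PV d ℓ m K hd hL) 0) :=
    (cB t x₀ hx₀ hfit).W.filter fun b => InWindow (fun b : PBond (PV d ℓ m K hd hL) 0 => (toBox hN b.src : Fin (d + 1) → ℤ)) x₀ Wd b
  have hfib := fun y => hfib_sites t D.toDomains (fun b : PBond (PV d ℓ m K hd hL) 0 => toBox hN b.src) (fun b => b.dir) x₀ hdiv Wd hWd
    hlev W' (fun b hb => (Finset.mem_filter.1 hb).2) y
  refine inMajorant_transplant (g := geomT D) (g' := tsGeo t 0 0) (blkV1 hN D) (fun b : PBond t.P 0 => iterBlockOf t.j b.src) S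
    (cB t x₀ hx₀ hfit).inj (h t 0 0) (fun _ _ => A) (fun _ _ => hA) (fun x _ x₁ _ _ => ?_) ((ℓ + 1) ^ (d + 1)) (fun y hy => ?_)
  · -- `A·e^{−δ d} ≤ A`
    have hnn := t.tdist_nonneg (iterBlockOf t.j ((cB t x₀ hx₀ hfit).e x).src) (iterBlockOf t.j ((cB t x₀ hx₀ hfit).e x₁).src)
    have : Real.exp (-(δ * t.tdist (iterBlockOf t.j ((cB t x₀ hx₀ hfit).e x).src) (iterBlockOf t.j ((cB t x₀ hx₀ hfit).e x₁).src))) ≤ 1 :=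
      Real.exp_le_one_iff.2 (by nlinarith)
    nlinarith
  · obtain ⟨T, hTn, hT⟩ := hfib y
    refine ⟨T, hTn, fun x hx hxy => ?_⟩
    have hxw : x ∈ W' := Finset.mem_filter.2 ⟨hx, hS x (hxy ▸ hy)⟩
    have hx0 : x ∈ DeepB t x₀ 0 := (mem_cB_W (hx₀ := hx₀) (hfit := hfit)).1 hx
    have he : (cB t x₀ hx₀ hfit).e x = chartBond t (fun b : PBond (PV d ℓ m K hd hL) 0 => (toBox hN b.src : Fin (d + 1) → ℤ)) (fun b => b.dir) x₀ x :=
      eB_eq_chartBond hx0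
    rw [he]
    exact hT x hxw hxy

end Uniform

end Literature.MathematicalPhysics.QuantumFieldTheory.Balaban1983to89.B6InMajorantTransplant

end
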